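import Literature.Analysis.FluidPDE.NSHopfGalerkinExistence
import Literature.Analysis.FluidPDE.ZerothLaw
import Literature.Analysis.FunctionSpaces.TorusEnstrophyOrthogonality
import HarnessLib

/-!
# The enstrophy identity of the Fourier–Galerkin system; two dimensions

Trunk: FluidKinetic (`Literature/Analysis/FluidPDE`). Companion to the Fourier–Galerkin machinery
of Hopf's existence theorem on the torus (`NSGalerkinFourier`, `NSHopfGalerkinExistence`: the
Galerkin ODE `ċ = V(g, c)`, `V = Torus.galerkinField`, its tested identity and its *energy*
identity `½ d/dt‖u‖² + ν‖∇u‖² = (G, u)`). This file proves the *enstrophy* identity of the same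
system — the Galerkin-level form of Foias–Manley–Rosa–Temam 2001, App. II.A (A.55),
`½ d/dt ‖u‖² + ν|Au|² + b(u, u, Au) = (f, Au)` (`‖u‖ = |∇u|`, `A = -Δ`), and, on `𝕋²`, of its
reduction (A.65) `½ d/dt‖u‖² + ν|Au|² = (f, Au)` by the orthogonality (A.62) `b(u,u,Au) = 0`
("In the 2-dimensional space-periodic case, the orthogonality property (A.62) holds", op. cit.
Remark 7.1, PDF p. 73; proof of (A.62) in the tree: `TorusEnstrophyOrthogonality`). For the
Galerkin system the identity is exact because the Laplacian commutes with the Galerkin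
projection: `Δu` is itself a Galerkin mode, so master identity I of `NSGalerkinFourier` can be
tested against it (Constantin–Foias 1988, Ch. 8; Temam 1977, Ch. III §3.2).

## Contents (all proved)

* `NS.eLaplacianNormSq_realTrigPoly`, `NS.toReal_eLaplacianNormSq_coeffExt` — the spectral
  enstrophy-dissipation density `‖Δu‖₂² = 16π⁴ ∑ |k|⁴ ‖c k‖²` of a real trigonometric polynomial
  (`eLaplacianNormSq` of `ZerothLaw`);
* `NS.sum_freqNormSq_mul_re_inner_galerkinField_self` — **master identity III** (every
  dimension): `4π² ∑_{k∈S} |k|² Re⟪c k, V(g,c) k⟫ = ∫⟪Δu, (u·∇)u⟫ - ν‖Δu‖₂² - ∫⟪G, Δu⟫`;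
* `NS.hasDerivWithinAt_enstrophy` (every dimension) and `NS.hasDerivWithinAt_enstrophy_fin_two`
  — the enstrophy identity in differential form along a Galerkin solution, on `𝕋²` without the
  cubic term;
* `NS.galerkin_enstrophy_identity_fin_two` — the integrated form on `[s, t]`,
  `½‖∇u(t)‖₂² + ν∫ₛᵗ‖Δu‖₂² = ½‖∇u(s)‖₂² - ∫ₛᵗ∫⟪G, Δu⟫` (FTC, as for
  `NS.galerkin_energy_identity`), with `NS.lintegral_eLaplacianNormSq_galerkin_lt_top`.

These feed the two-dimensional enstrophy bounds of Galerkin limits (uniform `L^∞H¹ ∩ L²H²`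
bounds and the enstrophy inequality of the Leray–Hopf limit), towards the discharge of the 2-D
regularity inputs of the Alexakis–Doering bounds (`AlexakisDoering`, `AlexakisDoeringProofs`)
and of Marchioro's theorem (`Literature/Barriers/AnomalousDissipation/GravestModeLaminarAttractor*`).

## Mathlib / tree search

Reused from the tree: `Torus.sum_re_inner_galerkinField_test` (master identity I),
`Torus.laplacian_realTrigPoly`, `Torus.integral_inner_convect_eq_neg`,
`Torus.integral_inner_laplacian_comm`, `Torus.integral_inner_laplacian_convect_self_eq_zero`
(FMRT (A.62)), `NS.hasDerivWithinAt_sum_norm_sq` as the model of the coefficient calculus.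
Nothing on enstrophy identities of Galerkin systems existed (searched `enstrophy`,
`eLaplacianNormSq_realTrigPoly`, `freqNormSq_mul_norm_sq`).

## References

* C. Foias, O. Manley, R. Rosa, R. Temam, *Navier–Stokes Equations and Turbulence*, CUP 2001,
  Ch. II Remark 7.1 (PDF p. 73), App. II.A (A.55), (A.62), (A.65) (PDF pp. 117–118).
  [FoiasManleyRosaTemam2001]
* P. Constantin, C. Foias, *Navier–Stokes Equations*, Chicago 1988, Ch. 8, (8.3)–(8.9).
* R. Temam, *Navier–Stokes Equations*, North-Holland 1977, Ch. III §3.2.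
-/

open MeasureTheory Set Filter UnitAddTorus
open scoped ENNReal NNReal InnerProductSpace

noncomputable section

namespace Literature.Analysis.FluidPDE

section NS

open FunctionSpaces.Torus Torus

variable {d : Type*} [Fintype d]

/-! ### The spectral Laplacian norm of a real trigonometric polynomial -/

section Spectral

variable {S : Finset (d → ℤ)}

/-- **Spectral Laplacian norm of a real trigonometric polynomial**:
`‖Δ(realTrigPoly S c)‖₂² = ofReal (16π⁴ ∑_{k∈S} |k|⁴ ‖c k‖²)` (conjugate-symmetric `c`,
symmetric `S`; the series defining `Torus.eHomSobolevSeminorm 2` is a finite sum). [folklore] -/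
theorem eLaplacianNormSq_realTrigPoly (hS : ∀ k ∈ S, -k ∈ S)
    {c : (d → ℤ) → EuclideanSpace ℂ d} (hc : IsConjSymm c) :
    eLaplacianNormSq (realTrigPoly S c) =
      ENNReal.ofReal (16 * Real.pi ^ 4 * ∑ k ∈ S, freqNormSq k ^ 2 * ‖c k‖ ^ 2) := by
  rw [eLaplacianNormSq, eHomSobolevSeminorm, ENNReal.rpow_half_sq]
  simp_rw [mFourierCoeff_realTrigPoly hS hc]
  rw [tsum_eq_sum (s := S) fun k hk => by simp [hk]]
  have hterm : ∀ k ∈ S, (if k = 0 then 0 else ENNReal.ofReal (freqNormSq k ^ (2 : ℝ))) *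
      ‖(if k ∈ S then c k else 0)‖ₑ ^ 2 = ENNReal.ofReal (freqNormSq k ^ 2 * ‖c k‖ ^ 2) := by
    intro k hk
    rw [if_pos hk, Real.rpow_two, ENNReal.ofReal_mul (sq_nonneg _), ← ofReal_norm,
      ← ENNReal.ofReal_pow (norm_nonneg _)]
    by_cases h0 : k = 0
    · subst h0; simp [freqNormSq_zero]
    · rw [if_neg h0]
  rw [Finset.sum_congr rfl hterm, ← ENNReal.ofReal_sum_of_nonneg fun k _ =>
      mul_nonneg (sq_nonneg _) (sq_nonneg _),
    ← ENNReal.ofReal_mul (by positivity : (0 : ℝ) ≤ 16 * Real.pi ^ 4)]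

/-- The spectral Laplacian norm of a real trigonometric polynomial, real form. [folklore] -/
theorem toReal_eLaplacianNormSq_realTrigPoly (hS : ∀ k ∈ S, -k ∈ S)
    {c : (d → ℤ) → EuclideanSpace ℂ d} (hc : IsConjSymm c) :
    (eLaplacianNormSq (realTrigPoly S c)).toReal =
      16 * Real.pi ^ 4 * ∑ k ∈ S, freqNormSq k ^ 2 * ‖c k‖ ^ 2 := by
  rw [eLaplacianNormSq_realTrigPoly hS hc, ENNReal.toReal_ofReal]
  exact mul_nonneg (by positivity) (Finset.sum_nonneg fun k _ =>
    mul_nonneg (sq_nonneg _) (sq_nonneg _))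

/-- The spectral Laplacian norm of a Galerkin state `realTrigPoly S (coeffExt S c)`, real form:
`16π⁴ ∑_k |k|⁴ ‖c k‖²`. [folklore] -/
theorem toReal_eLaplacianNormSq_coeffExt (hS : ∀ k ∈ S, -k ∈ S) {c : ↥S → EuclideanSpace ℂ d}
    (hc : IsRealCoeff c) :
    (eLaplacianNormSq (realTrigPoly S (coeffExt S c))).toReal =
      16 * Real.pi ^ 4 * ∑ k : ↥S, freqNormSq (k : d → ℤ) ^ 2 * ‖c k‖ ^ 2 := by
  rw [toReal_eLaplacianNormSq_realTrigPoly hS (hc.isConjSymm_coeffExt hS),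
    sum_coeffExt (fun k v => freqNormSq k ^ 2 * ‖v‖ ^ 2)]

/-- The spectral Laplacian norm of a Galerkin state in `ℝ≥0∞`. [folklore] -/
theorem eLaplacianNormSq_coeffExt (hS : ∀ k ∈ S, -k ∈ S) {c : ↥S → EuclideanSpace ℂ d}
    (hc : IsRealCoeff c) :
    eLaplacianNormSq (realTrigPoly S (coeffExt S c)) =
      ENNReal.ofReal (16 * Real.pi ^ 4 * ∑ k : ↥S, freqNormSq (k : d → ℤ) ^ 2 * ‖c k‖ ^ 2) := by
  rw [eLaplacianNormSq_realTrigPoly hS (hc.isConjSymm_coeffExt hS),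
    sum_coeffExt (fun k v => freqNormSq k ^ 2 * ‖v‖ ^ 2)]

/-- The coefficients of the Laplacian of a real trigonometric polynomial,
`k ↦ -4π²|k|² c k`, are conjugate symmetric when `c` is. [folklore] -/
theorem isConjSymm_laplacianCoeff {c : (d → ℤ) → EuclideanSpace ℂ d} (hc : IsConjSymm c) :
    IsConjSymm fun k => -(((4 * Real.pi ^ 2 * freqNormSq k : ℝ) : ℂ) • c k) := by
  intro k
  simp only [freqNormSq_neg, hc k]
  rw [FunctionSpaces.EuclideanSpace.conjVec_neg, FunctionSpaces.EuclideanSpace.conjVec_smul,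
    Complex.conj_ofReal]

/-- The coefficients of the Laplacian of a real trigonometric polynomial are transversal on `S`
when `c` is. [folklore] -/
theorem isTransversal_laplacianCoeff {c : (d → ℤ) → EuclideanSpace ℂ d} (hcT : IsTransversal S c) :
    IsTransversal S fun k => -(((4 * Real.pi ^ 2 * freqNormSq k : ℝ) : ℂ) • c k) := by
  intro k hk
  have h := hcT k hk
  simp only [PiLp.neg_apply, PiLp.smul_apply, smul_eq_mul, mul_neg, Finset.sum_neg_distrib,
    neg_eq_zero]
  calc ∑ j, (k j : ℂ) * ((((4 * Real.pi ^ 2 * freqNormSq k : ℝ) : ℂ)) * c k j)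
      = (((4 * Real.pi ^ 2 * freqNormSq k : ℝ) : ℂ)) * ∑ j, (k j : ℂ) * c k j := by
        rw [Finset.mul_sum]; exact Finset.sum_congr rfl fun j _ => by ring
    _ = 0 := by rw [h, mul_zero]

end Spectral

/-! ### The enstrophy identity in differential form (every dimension) -/

section Enstrophy

variable [DecidableEq d] {S : Finset (d → ℤ)}

omit [DecidableEq d] in
/-- Derivative of the weighted coefficient sum `∑_k |k|² ‖β k‖²` along a differentiable curve in
`S → ℂ^d`: `d/dt ∑_k |k|² ‖β k‖² = ∑_k |k|² · 2 Re ⟪β k, β' k⟫`. [folklore] -/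
theorem hasDerivWithinAt_sum_freqNormSq_mul_norm_sq {β : ℝ → ↥S → EuclideanSpace ℂ d}
    {v : ↥S → EuclideanSpace ℂ d} {s : Set ℝ} {t : ℝ} (h : HasDerivWithinAt β v s t) :
    HasDerivWithinAt (fun τ => ∑ k : ↥S, freqNormSq (k : d → ℤ) * ‖β τ k‖ ^ 2)
      (∑ k : ↥S, freqNormSq (k : d → ℤ) * (2 * (inner ℂ (β t k) (v k)).re)) s t := by
  have hk : ∀ k : ↥S, HasDerivWithinAt (fun τ => β τ k) (v k) s t := fun k =>
    (ContinuousLinearMap.proj (R := ℝ) (φ := fun _ : ↥S => EuclideanSpace ℂ d) k).hasFDerivAt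
      |>.comp_hasDerivWithinAt t h
  have := HasDerivWithinAt.fun_sum (u := Finset.univ) fun k _ =>
    ((hk k).norm_sq).const_mul (freqNormSq (k : d → ℤ))
  simp only [real_inner_eq_re_inner_euclidean] at this
  convert this using 1

/-- **Master identity III (enstrophy identity in differential form, every dimension).** For `S`
symmetric, `c` conjugate symmetric and transversal on `S`, `g` conjugate symmetric,
`u = realTrigPoly S c`, `G = realTrigPoly S g`:
`4π² ∑_{k∈S} |k|² Re⟪c k, galerkinField ν S g c k⟫ = ∫⟪Δu, (u·∇)u⟫ - ν‖Δu‖₂² - ∫⟪G, Δu⟫`,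
`‖Δu‖₂² = (eLaplacianNormSq u).toReal`. This is master identity I
(`Torus.sum_re_inner_galerkinField_test`) tested against `a = Δu = realTrigPoly S (-4π²|k|² c k)`
— a smooth divergence-free field band-limited to `S`, so that the Galerkin projection is
invisible — followed by `∫⟪u, (u·∇)Δu⟫ = -∫⟪Δu, (u·∇)u⟫` (antisymmetry of the trilinear form)
and `∫⟪u, ΔΔu⟫ = ∫⟪Δu, Δu⟫ = ‖Δu‖₂²` (Green). It is the Galerkin form of FMRT 2001, App. II.A
(A.55), `½ d/dt‖u‖² + ν|Au|² + b(u,u,Au) = (f, Au)` with `A = -Δ` commuting with `P_S`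
(Constantin–Foias 1988, Ch. 8; Temam 1977, Ch. III §3.2). [cite: FoiasManleyRosaTemam2001, App. II.A (A.55)] -/
theorem sum_freqNormSq_mul_re_inner_galerkinField_self (ν : ℝ) (hS : ∀ k ∈ S, -k ∈ S)
    {g c : (d → ℤ) → EuclideanSpace ℂ d} (hg : IsConjSymm g) (hc : IsConjSymm c)
    (hcT : IsTransversal S c) :
    4 * Real.pi ^ 2 * ∑ k ∈ S, freqNormSq k * (inner ℂ (c k) (galerkinField ν S g c k)).re =
      (∫ x, ⟪laplacian (realTrigPoly S c) x,
          FunctionSpaces.Torus.convect (realTrigPoly S c) (realTrigPoly S c) x⟫_ℝ) -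
        ν * (eLaplacianNormSq (realTrigPoly S c)).toReal -
        ∫ x, ⟪realTrigPoly S g x, laplacian (realTrigPoly S c) x⟫_ℝ := by
  set u := realTrigPoly S c with hu_def
  set c' : (d → ℤ) → EuclideanSpace ℂ d :=
    fun k => -(((4 * Real.pi ^ 2 * freqNormSq k : ℝ) : ℂ) • c k) with hc'_def
  have hu : IsSmooth u := isSmooth_realTrigPoly S c
  have hudiv : IsDivFree u := isDivFree_realTrigPoly hcT
  have hlap : laplacian u = realTrigPoly S c' := funext fun x => laplacian_realTrigPoly S c x
  have hc' : IsConjSymm c' := isConjSymm_laplacianCoeff hc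
  have hc'T : IsTransversal S c' := isTransversal_laplacianCoeff hcT
  have ha : IsSmooth (laplacian u) := hu.laplacian
  have hadiv : IsDivFree (laplacian u) := by rw [hlap]; exact isDivFree_realTrigPoly hc'T
  have hband : ∀ k ∉ S, mFourierCoeff (FunctionSpaces.EuclideanSpace.complexify ∘ laplacian u) k = 0 := by
    intro k hk; rw [hlap]; exact mFourierCoeff_realTrigPoly_eq_zero hS hc' hk
  have hcoef : ∀ k ∈ S, mFourierCoeff (FunctionSpaces.EuclideanSpace.complexify ∘ laplacian u) k = c' k := by
    intro k hk; rw [hlap, mFourierCoeff_realTrigPoly hS hc', if_pos hk]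
  have hI := sum_re_inner_galerkinField_test ν hS hg hc hcT ha hadiv hband
  rw [← hu_def] at hI
  -- the left-hand side of master identity I against `Δu`
  have hL : ∑ k ∈ S, (inner ℂ (galerkinField ν S g c k)
      (mFourierCoeff (FunctionSpaces.EuclideanSpace.complexify ∘ laplacian u) k)).re =
      -(4 * Real.pi ^ 2 * ∑ k ∈ S, freqNormSq k * (inner ℂ (c k) (galerkinField ν S g c k)).re) := by
    rw [Finset.mul_sum, ← Finset.sum_neg_distrib]
    refine Finset.sum_congr rfl fun k hk => ?_
    rw [hcoef k hk, hc'_def]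
    dsimp only
    rw [inner_neg_right, Complex.neg_re, inner_smul_right, Complex.re_ofReal_mul,
      ← inner_conj_symm, Complex.conj_re]
    ring
  -- the three physical terms
  have h1 : ∫ x, ⟪u x, FunctionSpaces.Torus.convect u (laplacian u) x⟫_ℝ = -∫ x, ⟪laplacian u x, FunctionSpaces.Torus.convect u u x⟫_ℝ := by
    have h := integral_inner_convect_eq_neg hu hudiv hu ha
    have hsym : ∫ x, ⟪FunctionSpaces.Torus.convect u u x, laplacian u x⟫_ℝ = ∫ x, ⟪laplacian u x, FunctionSpaces.Torus.convect u u x⟫_ℝ :=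
      integral_congr_ae (ae_of_all _ fun x => real_inner_comm _ _)
    linarith
  have h2 : ∫ x, ⟪u x, laplacian (laplacian u) x⟫_ℝ = (eLaplacianNormSq u).toReal := by
    rw [← integral_inner_laplacian_comm hu ha, hlap,
      integral_inner_realTrigPoly_realTrigPoly hS hc' hc', hu_def,
      toReal_eLaplacianNormSq_realTrigPoly hS hc, Finset.mul_sum]
    refine Finset.sum_congr rfl fun k _ => ?_
    have hcc : (inner ℂ (c' k) (c' k)).re = ‖c' k‖ ^ 2 := inner_self_eq_norm_sq (𝕜 := ℂ) (c' k)
    rw [hcc, hc'_def]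
    dsimp only
    rw [norm_neg, norm_smul, Complex.norm_real, Real.norm_of_nonneg
      (mul_nonneg (by positivity) (freqNormSq_nonneg k))]
    ring
  -- split the integral of master identity I
  have hi1 : Integrable (fun x => ⟪u x, FunctionSpaces.Torus.convect u (laplacian u) x⟫_ℝ) volume :=
    (hu.inner (hu.convect ha)).integrable
  have hi2 : Integrable (fun x => ν * ⟪u x, laplacian (laplacian u) x⟫_ℝ) volume :=
    ((hu.inner ha.laplacian).integrable).const_mul ν
  have hi3 : Integrable (fun x => ⟪realTrigPoly S g x, laplacian u x⟫_ℝ) volume :=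
    ((isSmooth_realTrigPoly S g).inner ha).integrable
  have hi12 : Integrable (fun x => ⟪u x, FunctionSpaces.Torus.convect u (laplacian u) x⟫_ℝ +
      ν * ⟪u x, laplacian (laplacian u) x⟫_ℝ) volume := hi1.add hi2
  rw [integral_add hi12 hi3, integral_add hi1 hi2, integral_const_mul, hL, h1, h2] at hI
  linarith

/-- **The enstrophy identity in differential form along a Galerkin solution (every
dimension).** If `β' = V(g, β)` within `s` at `t`, with `β t` real divergence free and `g` real,
then, with `u = realTrigPoly S β̄`, `G = realTrigPoly S ḡ`,
`d/dt (4π² ∑_k |k|² ‖β k‖²) = 2 (∫⟪Δu, (u·∇)u⟫ - ν‖Δu‖₂² - ∫⟪G, Δu⟫)`; the differentiated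
quantity is `‖∇u‖₂²` (`NS.toReal_eGradNormSq_coeffExt`). FMRT 2001, App. II.A (A.55) at the
Galerkin level. [cite: FoiasManleyRosaTemam2001, App. II.A (A.55)] -/
theorem hasDerivWithinAt_enstrophy (ν : ℝ) (hS : ∀ k ∈ S, -k ∈ S)
    {β : ℝ → ↥S → EuclideanSpace ℂ d} {g : ↥S → EuclideanSpace ℂ d} {s : Set ℝ} {t : ℝ}
    (h : HasDerivWithinAt β (galerkinRHS S ν g (β t)) s t) (hβ : β t ∈ galerkinSubspace S)
    (hg : IsRealCoeff g) :
    HasDerivWithinAt (fun τ => 4 * Real.pi ^ 2 * ∑ k : ↥S, freqNormSq (k : d → ℤ) * ‖β τ k‖ ^ 2)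
      (2 * ((∫ x, ⟪laplacian (realTrigPoly S (coeffExt S (β t))) x,
          FunctionSpaces.Torus.convect (realTrigPoly S (coeffExt S (β t))) (realTrigPoly S (coeffExt S (β t))) x⟫_ℝ) -
        ν * (eLaplacianNormSq (realTrigPoly S (coeffExt S (β t)))).toReal -
        ∫ x, ⟪realTrigPoly S (coeffExt S g) x,
          laplacian (realTrigPoly S (coeffExt S (β t))) x⟫_ℝ)) s t := by
  have h1 := (hasDerivWithinAt_sum_freqNormSq_mul_norm_sq h).const_mul (4 * Real.pi ^ 2)
  have h2 : 4 * Real.pi ^ 2 * ∑ k : ↥S, freqNormSq (k : d → ℤ) *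
      (2 * (inner ℂ (β t k) (galerkinRHS S ν g (β t) k)).re) =
      2 * (4 * Real.pi ^ 2 * ∑ k ∈ S, freqNormSq k * (inner ℂ (coeffExt S (β t) k)
        (galerkinField ν S (coeffExt S g) (coeffExt S (β t)) k)).re) := by
    rw [sum_coeffExt (fun k v => freqNormSq k * (inner ℂ v
      (galerkinField ν S (coeffExt S g) (coeffExt S (β t)) k)).re), Finset.mul_sum,
      Finset.mul_sum, Finset.mul_sum]
    refine Finset.sum_congr rfl fun k _ => ?_
    rw [galerkinRHS_apply]
    ring
  rw [h2, sum_freqNormSq_mul_re_inner_galerkinField_self ν hS (hg.isConjSymm_coeffExt hS)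
    (hβ.1.isConjSymm_coeffExt hS) hβ.2.isTransversal_coeffExt] at h1
  exact h1

end Enstrophy

/-! ### Two dimensions: the cubic term drops out; the integrated enstrophy identity -/

section TwoDim

variable {S : Finset (Fin 2 → ℤ)}

/-- **The 2-D enstrophy identity in differential form along a Galerkin solution**: on `𝕋²`
the cubic term `∫⟪Δu, (u·∇)u⟫` vanishes (`Torus.integral_inner_laplacian_convect_self_eq_zero`,
FMRT 2001, App. II.A (A.62)), so `d/dt ‖∇u‖₂² = 2(-ν‖Δu‖₂² - ∫⟪G, Δu⟫)`, i.e.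
`½ d/dt‖∇u‖² + ν|Au|² = (G, Au)`, `A = -Δ` — FMRT (A.65) for the Galerkin system. [cite: FoiasManleyRosaTemam2001, App. II.A (A.65)] -/
theorem hasDerivWithinAt_enstrophy_fin_two (ν : ℝ) (hS : ∀ k ∈ S, -k ∈ S)
    {β : ℝ → ↥S → EuclideanSpace ℂ (Fin 2)} {g : ↥S → EuclideanSpace ℂ (Fin 2)} {s : Set ℝ}
    {t : ℝ} (h : HasDerivWithinAt β (galerkinRHS S ν g (β t)) s t)
    (hβ : β t ∈ galerkinSubspace S) (hg : IsRealCoeff g) :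
    HasDerivWithinAt
      (fun τ => 4 * Real.pi ^ 2 * ∑ k : ↥S, freqNormSq (k : Fin 2 → ℤ) * ‖β τ k‖ ^ 2)
      (2 * (-(ν * (eLaplacianNormSq (realTrigPoly S (coeffExt S (β t)))).toReal) -
        ∫ x, ⟪realTrigPoly S (coeffExt S g) x,
          laplacian (realTrigPoly S (coeffExt S (β t))) x⟫_ℝ)) s t := by
  have h1 := hasDerivWithinAt_enstrophy ν hS h hβ hg
  rw [integral_inner_laplacian_convect_self_eq_zero (isSmooth_realTrigPoly S _)
    (isDivFree_realTrigPoly hβ.2.isTransversal_coeffExt)] at h1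
  convert h1 using 1
  ring

/-- The force term of the enstrophy identity as a finite sum of coefficients:
`∫⟪G, Δu⟫ = ∑_k Re⟪g k, -4π²|k|² α k⟫` for Galerkin states. [folklore] -/
theorem integral_inner_realTrigPoly_laplacian_eq_sum {d : Type*} [Fintype d] [DecidableEq d]
    {S : Finset (d → ℤ)} (hS : ∀ k ∈ S, -k ∈ S) {g c : ↥S → EuclideanSpace ℂ d}
    (hg : IsRealCoeff g) (hc : IsRealCoeff c) :
    ∫ x, ⟪realTrigPoly S (coeffExt S g) x, laplacian (realTrigPoly S (coeffExt S c)) x⟫_ℝ =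
      ∑ k : ↥S, (inner ℂ (g k)
        (-(((4 * Real.pi ^ 2 * freqNormSq (k : d → ℤ) : ℝ) : ℂ) • c k))).re := by
  have hlap : laplacian (realTrigPoly S (coeffExt S c)) = realTrigPoly S
      (fun k => -(((4 * Real.pi ^ 2 * freqNormSq k : ℝ) : ℂ) • coeffExt S c k)) :=
    funext fun x => laplacian_realTrigPoly S _ x
  rw [hlap, integral_inner_realTrigPoly_realTrigPoly hS (hg.isConjSymm_coeffExt hS)
    (isConjSymm_laplacianCoeff (hc.isConjSymm_coeffExt hS)), ← Finset.sum_coe_sort]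
  exact Finset.sum_congr rfl fun k _ => by rw [coeffExt_coe, coeffExt_coe]

/-- **The integrated enstrophy identity of 2-D Galerkin solutions** (FMRT 2001, App. II.A
(A.65) integrated over `[s, t]`, for the Fourier–Galerkin system; Constantin–Foias 1988, Ch. 8;
Temam 1977, Ch. III §3.2). Let `α` solve the Galerkin ODE on every `[0, T]` in the Galerkin
phase space of `𝕋²`, with continuous real force coefficients `g`, and put
`u(τ) = realTrigPoly S (α τ)`, `G(τ) = realTrigPoly S (g τ)`. Then for `0 ≤ s ≤ t`,
`½‖∇u(t)‖₂² + ν∫ₛᵗ‖Δu‖₂² = ½‖∇u(s)‖₂² - ∫ₛᵗ∫⟪G, Δu⟫`, the dissipation written as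
`(∫⁻_{(s,t)} eLaplacianNormSq (u τ)).toReal` (spectral norms `Torus.eGradNormSq`,
`eLaplacianNormSq`). [cite: FoiasManleyRosaTemam2001, App. II.A (A.65)] -/
theorem galerkin_enstrophy_identity_fin_two (ν : ℝ) (hS : ∀ k ∈ S, -k ∈ S)
    {g : ℝ → ↥S → EuclideanSpace ℂ (Fin 2)} (hg : Continuous g) (hgr : ∀ t, IsRealCoeff (g t))
    {α : ℝ → ↥S → EuclideanSpace ℂ (Fin 2)} (hmem : ∀ t, α t ∈ galerkinSubspace S)
    (hα : ∀ T, ∀ t ∈ Icc 0 T, HasDerivWithinAt α (galerkinRHS S ν (g t) (α t)) (Icc 0 T) t)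
    {s t : ℝ} (hs : 0 ≤ s) (hst : s ≤ t) :
    2⁻¹ * (eGradNormSq (realTrigPoly S (coeffExt S (α t)))).toReal +
        ν * (∫⁻ τ in Ioo s t, eLaplacianNormSq (realTrigPoly S (coeffExt S (α τ)))).toReal =
      2⁻¹ * (eGradNormSq (realTrigPoly S (coeffExt S (α s)))).toReal -
        ∫ τ in s..t, ∫ x, ⟪realTrigPoly S (coeffExt S (g τ)) x,
          laplacian (realTrigPoly S (coeffExt S (α τ))) x⟫_ℝ := by
  -- name the enstrophy, the Laplacian dissipation and the force term
  obtain ⟨ψ, hψ⟩ : ∃ ψ : ℝ → ℝ,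
      ψ = fun τ => 4 * Real.pi ^ 2 * ∑ k : ↥S, freqNormSq (k : Fin 2 → ℤ) * ‖α τ k‖ ^ 2 :=
    ⟨_, rfl⟩
  obtain ⟨Lap, hLap⟩ : ∃ L : ℝ → ℝ,
      L = fun τ => (eLaplacianNormSq (realTrigPoly S (coeffExt S (α τ)))).toReal := ⟨_, rfl⟩
  obtain ⟨P, hP⟩ : ∃ P : ℝ → ℝ, P = fun τ => ∫ x, ⟪realTrigPoly S (coeffExt S (g τ)) x,
      laplacian (realTrigPoly S (coeffExt S (α τ))) x⟫_ℝ := ⟨_, rfl⟩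
  have hderiv : ∀ T, ∀ τ ∈ Icc 0 T, HasDerivWithinAt ψ (2 * (-(ν * Lap τ) - P τ)) (Icc 0 T) τ := by
    intro T τ hτ
    subst hψ hLap hP
    exact hasDerivWithinAt_enstrophy_fin_two ν hS (hα T τ hτ) (hmem τ) (hgr τ)
  have hα_cont : ContinuousOn α (Icc 0 t) := fun τ hτ => (hα t τ hτ).continuousWithinAt
  -- continuity of the dissipation and of the force term on `[0, t]` (Fourier side)
  have hLap_eq : ∀ τ, Lap τ = 16 * Real.pi ^ 4 *
      ∑ k : ↥S, freqNormSq (k : Fin 2 → ℤ) ^ 2 * ‖α τ k‖ ^ 2 := by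
    intro τ; subst hLap; exact toReal_eLaplacianNormSq_coeffExt hS (hmem τ).1
  have hLap_cont : ContinuousOn Lap (Icc 0 t) := by
    rw [funext hLap_eq]
    refine continuousOn_const.mul (continuousOn_finsetSum _ fun k _ => ?_)
    exact continuousOn_const.mul (((continuous_apply k).comp_continuousOn hα_cont).norm.pow 2)
  have hP_eq : ∀ τ, P τ = ∑ k : ↥S, (inner ℂ (g τ k)
      (-(((4 * Real.pi ^ 2 * freqNormSq (k : Fin 2 → ℤ) : ℝ) : ℂ) • α τ k))).re := by
    intro τ
    subst hP
    exact integral_inner_realTrigPoly_laplacian_eq_sum hS (hgr τ) (hmem τ).1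
  have hP_cont : ContinuousOn P (Icc 0 t) := by
    rw [funext hP_eq]
    refine continuousOn_finsetSum _ fun k _ => Complex.continuous_re.comp_continuousOn ?_
    refine ((continuous_apply k).comp_continuousOn (hg.continuousOn (s := Icc 0 t))).inner ?_
    exact (((continuous_apply k).comp_continuousOn hα_cont).const_smul
      (((4 * Real.pi ^ 2 * freqNormSq (k : Fin 2 → ℤ) : ℝ) : ℂ))).neg
  have hsub : Icc s t ⊆ Icc 0 t := Icc_subset_Icc hs le_rfl
  have hLap_int : IntervalIntegrable Lap volume s t :=
    (hLap_cont.mono (by rw [uIcc_of_le hst]; exact hsub)).intervalIntegrable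
  have hP_int : IntervalIntegrable P volume s t :=
    (hP_cont.mono (by rw [uIcc_of_le hst]; exact hsub)).intervalIntegrable
  have hnegL_int : IntervalIntegrable (fun τ => -(ν * Lap τ)) volume s t :=
    (hLap_int.const_mul ν).neg
  -- FTC
  have hFTC : ∫ τ in s..t, 2 * (-(ν * Lap τ) - P τ) = ψ t - ψ s := by
    refine intervalIntegral.integral_eq_sub_of_hasDeriv_right_of_le hst ?_ ?_ ?_
    · exact fun τ hτ => ((hderiv t τ ⟨hs.trans hτ.1, hτ.2⟩).continuousWithinAt).mono hsub
    · intro τ hτ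
      have h := hderiv t τ ⟨hs.trans hτ.1.le, hτ.2.le⟩
      exact (h.hasDerivAt (Icc_mem_nhds (hs.trans_lt hτ.1) hτ.2)).hasDerivWithinAt
    · exact (hnegL_int.sub hP_int).const_mul 2
  have hsplit : ∫ τ in s..t, 2 * (-(ν * Lap τ) - P τ) =
      2 * (-(ν * ∫ τ in s..t, Lap τ) - ∫ τ in s..t, P τ) := by
    rw [intervalIntegral.integral_const_mul, intervalIntegral.integral_sub hnegL_int hP_int,
      intervalIntegral.integral_neg, intervalIntegral.integral_const_mul]
  -- the dissipation as a `lintegral`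
  have hlint : (∫⁻ τ in Ioo s t, eLaplacianNormSq (realTrigPoly S (coeffExt S (α τ)))).toReal =
      ∫ τ in s..t, Lap τ := by
    have heq : ∀ τ, eLaplacianNormSq (realTrigPoly S (coeffExt S (α τ))) =
        ENNReal.ofReal (Lap τ) := by
      intro τ
      rw [hLap_eq, eLaplacianNormSq_coeffExt hS (hmem τ).1]
    simp_rw [heq]
    have hint : IntegrableOn Lap (Ioo s t) volume :=
      ((hLap_cont.mono hsub).integrableOn_compact isCompact_Icc).mono_set Ioo_subset_Icc_self
    have hnn' : ∀ τ, 0 ≤ Lap τ := fun τ => by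
      rw [hLap_eq]
      exact mul_nonneg (by positivity) (Finset.sum_nonneg fun k _ =>
        mul_nonneg (sq_nonneg _) (sq_nonneg _))
    have hnn : 0 ≤ᵐ[volume.restrict (Ioo s t)] Lap := ae_of_all _ hnn'
    rw [← ofReal_integral_eq_lintegral_ofReal hint hnn, ENNReal.toReal_ofReal
      (integral_nonneg hnn'), intervalIntegral.integral_of_le hst, integral_Ioc_eq_integral_Ioo]
  -- assemble
  have hEt : (eGradNormSq (realTrigPoly S (coeffExt S (α t)))).toReal = ψ t := by
    rw [hψ]; exact toReal_eGradNormSq_coeffExt hS (hmem t).1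
  have hEs : (eGradNormSq (realTrigPoly S (coeffExt S (α s)))).toReal = ψ s := by
    rw [hψ]; exact toReal_eGradNormSq_coeffExt hS (hmem s).1
  have hPint_eq : ∫ τ in s..t, ∫ x, ⟪realTrigPoly S (coeffExt S (g τ)) x,
      laplacian (realTrigPoly S (coeffExt S (α τ))) x⟫_ℝ = ∫ τ in s..t, P τ := by rw [hP]
  rw [hEt, hEs, hlint, hPint_eq]
  rw [hsplit] at hFTC
  linarith

/-- The Laplacian dissipation of a 2-D Galerkin solution over a bounded interval is finite
(continuous integrand). [folklore] -/
theorem lintegral_eLaplacianNormSq_galerkin_lt_top (hS : ∀ k ∈ S, -k ∈ S)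
    {α : ℝ → ↥S → EuclideanSpace ℂ (Fin 2)} (hmem : ∀ t, α t ∈ galerkinSubspace S)
    {t : ℝ} (hα_cont : ContinuousOn α (Icc 0 t)) {s : ℝ} (hs : 0 ≤ s) :
    ∫⁻ τ in Ioo s t, eLaplacianNormSq (realTrigPoly S (coeffExt S (α τ))) < ∞ := by
  set Lap : ℝ → ℝ := fun τ => 16 * Real.pi ^ 4 *
      ∑ k : ↥S, freqNormSq (k : Fin 2 → ℤ) ^ 2 * ‖α τ k‖ ^ 2 with hLap
  have heq : ∀ τ, eLaplacianNormSq (realTrigPoly S (coeffExt S (α τ))) = ENNReal.ofReal (Lap τ) :=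
    fun τ => eLaplacianNormSq_coeffExt hS (hmem τ).1
  simp_rw [heq]
  have hLap_cont : ContinuousOn Lap (Icc 0 t) := by
    refine continuousOn_const.mul (continuousOn_finsetSum _ fun k _ => ?_)
    exact continuousOn_const.mul (((continuous_apply k).comp_continuousOn hα_cont).norm.pow 2)
  have hint : IntegrableOn Lap (Ioo s t) volume :=
    ((hLap_cont.mono (Icc_subset_Icc hs le_rfl)).integrableOn_compact isCompact_Icc).mono_set
      Ioo_subset_Icc_self
  exact hint.lintegral_lt_top

end TwoDim

end NS

end Literature.Analysis.FluidPDE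

end
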